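import Summits.CriticalPhenomena.PercolationContinuityZ3.Theorems.Transplant.FKThreeApexClusters
import HarnessLib

/-!
# Connectivity correlation inequalities for `φ_{w,q}` — the three-apex family: the CLUSTER COUNT of a leaf-by-leaf configuration

Support file (`--supports stmt-CriticalPhenomena-4575`), FK sub-lane `prim-bschramm-fk-3` (gen 12); builds on p205010 (kernel theorem, internal audit
signed; external expert review pending).  Pure finite graph theory; no named facts, no sorries; standard axioms.  Layer 2a′ of the `K_{1,1,1,n}`
programme (memo `bschramm/prim-bschramm-fk-3/THREE-APEX.md` §6).
Three distinct apices `a, b, c`, leaves `v 0, …, v (n-1)` (pairwise distinct, none an apex), an initial configuration `ω₀` of pairs among the apices,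
and for every leaf `i` an attachment pattern `att i = (x, y, z)` (rays to `a`, `b`, `c`).  `conf i` is `ω₀` plus the stars of the leaves `< i`
(`FK.ThreeApex.star`).  The abstract APEX PARTITION `P3 = {bot, ab, ac, bc, top}` is updated by `P3.attach`, and `P3.dec` counts the clusters that
disappear when a leaf is attached.  **`conf_inv`**: for every `i ≤ n`,
`k(conf i) + blocks π₀ + #{j < i attached} = k(ω₀) + blocks π_i`, apex reachability in `conf i` is read off `π_i`, and the leaves `≥ i` are still
fresh — i.e. `k = |π| + #isolated leaves + const`, the combinatorial half of the transfer formula `Z = ⟨g, M(z_n)⋯M(z_1)δ_0⟩` (layer 2b, by rigid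
interpolation). [cite: Grimmett2006, §1.2 eq. (1.1) (p. 4)] [folklore]
-/

noncomputable section

namespace Summit.CriticalPhenomena.PercolationContinuityZ3.Theorems

namespace FK

namespace ThreeApex

open Literature.Probability.LatticeModels Literature.Probability.Percolation
open scoped Classical

/-! ### The abstract apex partition -/

/-- Partitions of the three apices `{a, b, c}`. [folklore] -/
inductive P3
  | bot | ab | ac | bc | top
  deriving DecidableEq

namespace P3

/-- Number of blocks. [folklore] -/
def blocks : P3 → ℕ
  | bot => 3 | ab => 2 | ac => 2 | bc => 2 | top => 1

/-- `a` and `b` in the same block. [folklore] -/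
def rAB : P3 → Bool
  | ab => true | top => true | _ => false

/-- `a` and `c` in the same block. [folklore] -/
def rAC : P3 → Bool
  | ac => true | top => true | _ => false

/-- `b` and `c` in the same block. [folklore] -/
def rBC : P3 → Bool
  | bc => true | top => true | _ => false

/-- Join with the block `{a,b}`. [folklore] -/
def joinAB : P3 → P3
  | bot => ab | ab => ab | _ => top

/-- Join with the block `{a,c}`. [folklore] -/
def joinAC : P3 → P3
  | bot => ac | ac => ac | _ => top

/-- Join with the block `{b,c}`. [folklore] -/
def joinBC : P3 → P3
  | bot => bc | bc => bc | _ => top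

/-- Attaching a leaf with rays to `a` (if `x`), `b` (if `y`), `c` (if `z`): join with the block of the attached apices. [folklore] -/
def attach (π : P3) (x y z : Bool) : P3 :=
  let π₁ := if x && y then π.joinAB else π
  let π₂ := if x && z then π₁.joinAC else π₁
  if y && z then π₂.joinBC else π₂

/-- Number of open clusters that disappear when the leaf is attached ray by ray (`a`, then `b`, then `c`): the first ray absorbs the singleton
leaf, each later ray merges two clusters unless its apex is already joined to an earlier attached apex. [folklore] -/
def dec (π : P3) (x y z : Bool) : ℕ :=
  (if x then 1 else 0) + (if y then (if x && π.rAB then 0 else 1) else 0) +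
    (if z then (if (x && π.rAC) || (y && π.rBC) then 0 else 1) else 0)

/-- Block bookkeeping: `blocks (attach π x y z) + dec π x y z = blocks π + [leaf attached]`. [folklore] -/
theorem blocks_attach (π : P3) (x y z : Bool) :
    (π.attach x y z).blocks + π.dec x y z = π.blocks + (if x || y || z then 1 else 0) := by
  cases π <;> cases x <;> cases y <;> cases z <;> decide

/-- Reachability bookkeeping for `a, b`. [folklore] -/
theorem rAB_attach (π : P3) (x y z : Bool) :
    (π.attach x y z).rAB = (π.rAB || ((x || (y && π.rAB) || (z && π.rAC)) && ((x && π.rAB) || y || (z && π.rBC)))) := by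
  cases π <;> cases x <;> cases y <;> cases z <;> decide

/-- Reachability bookkeeping for `a, c`. [folklore] -/
theorem rAC_attach (π : P3) (x y z : Bool) :
    (π.attach x y z).rAC = (π.rAC || ((x || (y && π.rAB) || (z && π.rAC)) && ((x && π.rAC) || (y && π.rBC) || z))) := by
  cases π <;> cases x <;> cases y <;> cases z <;> decide

/-- Reachability bookkeeping for `b, c`. [folklore] -/
theorem rBC_attach (π : P3) (x y z : Bool) :
    (π.attach x y z).rBC = (π.rBC || (((x && π.rAB) || y || (z && π.rBC)) && ((x && π.rAC) || (y && π.rBC) || z))) := by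
  cases π <;> cases x <;> cases y <;> cases z <;> decide

end P3

/-! ### The concrete configuration -/

variable {V : Type*} [Fintype V] [DecidableEq V]

/-- The attachment set of a pattern `(x, y, z)`: `a` if `x`, then `b` if `y`, then `c` if `z` (as nested inserts). [folklore] -/
def attFin (a b c : V) (x y z : Bool) : Finset V :=
  let A₁ : Finset V := if x then {a} else ∅
  let A₂ : Finset V := if y then insert b A₁ else A₁
  if z then insert c A₂ else A₂

/-- The configuration after the first `i` leaves: `ω₀` plus their stars. [folklore] -/
def conf (a b c : V) (v : ℕ → V) (att : ℕ → Bool × Bool × Bool) (ω₀ : Finset (Sym2 V)) : ℕ → Finset (Sym2 V)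
  | 0 => ω₀
  | i + 1 => conf a b c v att ω₀ i ∪ star (v i) (attFin a b c (att i).1 (att i).2.1 (att i).2.2)

/-- The abstract apex partition after the first `i` leaves. [folklore] -/
def apexState (att : ℕ → Bool × Bool × Bool) (π₀ : P3) : ℕ → P3
  | 0 => π₀
  | i + 1 => (apexState att π₀ i).attach (att i).1 (att i).2.1 (att i).2.2

/-- Number of attached leaves among the first `i`. [folklore] -/
def attached (att : ℕ → Bool × Bool × Bool) : ℕ → ℕ
  | 0 => 0
  | i + 1 => attached att i + (if (att i).1 || (att i).2.1 || (att i).2.2 then 1 else 0)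

section Concrete

variable (a b c : V) (v : ℕ → V) (att : ℕ → Bool × Bool × Bool) (ω₀ : Finset (Sym2 V)) (π₀ : P3) (n : ℕ)

omit [Fintype V] in
/-- Membership in the attachment set. [folklore] -/
theorem mem_attFin (x y z : Bool) (w : V) :
    w ∈ attFin a b c x y z ↔ (x = true ∧ w = a) ∨ (y = true ∧ w = b) ∨ (z = true ∧ w = c) := by
  cases x <;> cases y <;> cases z <;> simp [attFin, or_comm, or_left_comm]

omit [Fintype V] in
/-- `∃ p ∈ attFin, P p` unfolded. [folklore] -/
theorem exists_mem_attFin (x y z : Bool) (P : V → Prop) :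
    (∃ p ∈ attFin a b c x y z, P p) ↔ (x = true ∧ P a) ∨ (y = true ∧ P b) ∨ (z = true ∧ P c) := by
  constructor
  · rintro ⟨p, hp, hP⟩
    rcases (mem_attFin a b c x y z p).1 hp with ⟨hx, rfl⟩ | ⟨hy, rfl⟩ | ⟨hz, rfl⟩
    · exact Or.inl ⟨hx, hP⟩
    · exact Or.inr (Or.inl ⟨hy, hP⟩)
    · exact Or.inr (Or.inr ⟨hz, hP⟩)
  · rintro (⟨hx, hP⟩ | ⟨hy, hP⟩ | ⟨hz, hP⟩)
    · exact ⟨a, (mem_attFin a b c x y z a).2 (Or.inl ⟨hx, rfl⟩), hP⟩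
    · exact ⟨b, (mem_attFin a b c x y z b).2 (Or.inr (Or.inl ⟨hy, rfl⟩)), hP⟩
    · exact ⟨c, (mem_attFin a b c x y z c).2 (Or.inr (Or.inr ⟨hz, rfl⟩)), hP⟩

/-- **Cluster count of one attachment step**: for `u` fresh in `ω`, `u ∉ {a,b,c}`, and Booleans `rab, rac, rbc` recording apex reachability in
`ω`, `k(ω ∪ star u (attFin x y z)) + dec = k(ω)` with `dec` the `P3.dec` formula written in the Booleans. [cite: Grimmett2006, §1.2 eq. (1.1) (p. 4)] -/
theorem clusterCount_attach (ω : Finset (Sym2 V)) {u : V} (hu : ∀ e ∈ ω, u ∉ e) (hua : u ≠ a) (hub : u ≠ b) (huc : u ≠ c)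
    (x y z rab rac rbc : Bool)
    (hrab : (openGraph (↑ω : BondConfig V)).Reachable a b ↔ rab = true)
    (hrac : (openGraph (↑ω : BondConfig V)).Reachable a c ↔ rac = true)
    (hrbc : (openGraph (↑ω : BondConfig V)).Reachable b c ↔ rbc = true) :
    clusterCount (↑(ω ∪ star u (attFin a b c x y z)) : BondConfig V) (∅ : Set V) +
        ((if x then 1 else 0) + (if y then (if x && rab then 0 else 1) else 0) +
          (if z then (if (x && rac) || (y && rbc) then 0 else 1) else 0)) =
      clusterCount (↑ω : BondConfig V) (∅ : Set V) := by
  -- step 1: the ray to `a`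
  set A₁ : Finset V := if x then {a} else ∅ with hA₁
  have huA₁ : u ∉ A₁ := by rw [hA₁]; split_ifs <;> simp [hua]
  have h1 : clusterCount (↑(ω ∪ star u A₁) : BondConfig V) (∅ : Set V) + (if x then 1 else 0) =
      clusterCount (↑ω : BondConfig V) (∅ : Set V) := by
    rw [hA₁]; cases x
    · simp
    · simp only [ite_true]
      have h := clusterCount_union_star_insert ω hu (A := (∅ : Finset V)) (by simp) (x := a) hua.symm
      rw [if_neg (by simp)] at h
      simpa using h
  -- step 2: the ray to `b`
  set A₂ : Finset V := if y then insert b A₁ else A₁ with hA₂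
  have huA₂ : u ∉ A₂ := by rw [hA₂]; split_ifs <;> simp [hub, huA₁]
  have hbA₁ : ∀ P : V → Prop, (∃ p ∈ A₁, P p) ↔ (x = true ∧ P a) := by
    intro P; rw [hA₁]; cases x <;> simp
  have h2 : clusterCount (↑(ω ∪ star u A₂) : BondConfig V) (∅ : Set V) + (if y then (if x && rab then 0 else 1) else 0) =
      clusterCount (↑(ω ∪ star u A₁) : BondConfig V) (∅ : Set V) := by
    rw [hA₂]; cases y
    · simp
    · simp only [ite_true]
      have h := clusterCount_union_star_insert ω hu huA₁ (x := b) hub.symm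
      have e : (∃ x' ∈ A₁, (openGraph (↑ω : BondConfig V)).Reachable b x') ↔ (x && rab) = true := by
        rw [hbA₁, Bool.and_eq_true, SimpleGraph.reachable_comm, hrab]
      by_cases hc : (x && rab) = true
      · rw [if_pos hc]; rw [if_pos (e.2 hc)] at h; exact h
      · rw [if_neg hc]; rw [if_neg (fun h' => hc (e.1 h'))] at h; exact h
  -- step 3: the ray to `c`
  have hcA₂ : ∀ P : V → Prop, (∃ p ∈ A₂, P p) ↔ (x = true ∧ P a) ∨ (y = true ∧ P b) := by
    intro P; rw [hA₂]; cases y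
    · simp [hbA₁]
    · simp only [ite_true, Finset.exists_mem_insert, hbA₁]; tauto
  have h3 : clusterCount (↑(ω ∪ star u (attFin a b c x y z)) : BondConfig V) (∅ : Set V) +
      (if z then (if (x && rac) || (y && rbc) then 0 else 1) else 0) =
      clusterCount (↑(ω ∪ star u A₂) : BondConfig V) (∅ : Set V) := by
    have hF : attFin a b c x y z = if z then insert c A₂ else A₂ := rfl
    rw [hF]; cases z
    · simp
    · simp only [ite_true]
      have h := clusterCount_union_star_insert ω hu huA₂ (x := c) huc.symm
      have e : (∃ x' ∈ A₂, (openGraph (↑ω : BondConfig V)).Reachable c x') ↔ ((x && rac) || (y && rbc)) = true := by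
        rw [hcA₂, Bool.or_eq_true, Bool.and_eq_true, Bool.and_eq_true, SimpleGraph.reachable_comm, hrac,
          SimpleGraph.reachable_comm (u := c), hrbc]
      by_cases hc : ((x && rac) || (y && rbc)) = true
      · rw [if_pos hc]; rw [if_pos (e.2 hc)] at h; exact h
      · rw [if_neg hc]; rw [if_neg (fun h' => hc (e.1 h'))] at h; exact h
  omega

/-- **The invariant of the leaf-by-leaf construction.**  Hypotheses: the leaves `v j` (`j < n`) pairwise distinct and not
apices; every pair of `ω₀` joins two apices; apex reachability in `ω₀` is read off `π₀`.  Then for every `i ≤ n`: (count)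
`k(conf i) + blocks π₀ + attached i = k(ω₀) + blocks π_i`; (reach) apex reachability in `conf i` is read off `π_i = apexState i`;
(fresh) the leaves `v j`, `i ≤ j < n`, are met by no pair of `conf i`. [cite: Grimmett2006, §1.2 eq. (1.1) (p. 4)] -/
theorem conf_inv (hinj : ∀ j k, j < n → k < n → v j = v k → j = k)
    (hva : ∀ j, j < n → v j ≠ a) (hvb : ∀ j, j < n → v j ≠ b) (hvc : ∀ j, j < n → v j ≠ c)
    (hω₀ : ∀ e ∈ ω₀, ∀ w ∈ e, w = a ∨ w = b ∨ w = c)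
    (h0ab : (openGraph (↑ω₀ : BondConfig V)).Reachable a b ↔ π₀.rAB = true)
    (h0ac : (openGraph (↑ω₀ : BondConfig V)).Reachable a c ↔ π₀.rAC = true)
    (h0bc : (openGraph (↑ω₀ : BondConfig V)).Reachable b c ↔ π₀.rBC = true) :
    ∀ i, i ≤ n →
      clusterCount (↑(conf a b c v att ω₀ i) : BondConfig V) (∅ : Set V) + π₀.blocks + attached att i =
          clusterCount (↑ω₀ : BondConfig V) (∅ : Set V) + (apexState att π₀ i).blocks ∧
      ((openGraph (↑(conf a b c v att ω₀ i) : BondConfig V)).Reachable a b ↔ (apexState att π₀ i).rAB = true) ∧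
      ((openGraph (↑(conf a b c v att ω₀ i) : BondConfig V)).Reachable a c ↔ (apexState att π₀ i).rAC = true) ∧
      ((openGraph (↑(conf a b c v att ω₀ i) : BondConfig V)).Reachable b c ↔ (apexState att π₀ i).rBC = true) ∧
      (∀ j, i ≤ j → j < n → ∀ e ∈ conf a b c v att ω₀ i, v j ∉ e) := by
  intro i
  induction i with
  | zero =>
    intro _
    refine ⟨by simp [conf, apexState, attached], by simpa [conf, apexState] using h0ab, by simpa [conf, apexState] using h0ac,
      by simpa [conf, apexState] using h0bc, ?_⟩
    intro j _ hj e he hv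
    rcases hω₀ e he (v j) hv with h | h | h
    · exact hva j hj h
    · exact hvb j hj h
    · exact hvc j hj h
  | succ i ih =>
    intro hi
    have hi' : i < n := Nat.lt_of_succ_le hi
    obtain ⟨ihk, ihab, ihac, ihbc, ihfresh⟩ := ih hi'.le
    -- data of the step
    set ω := conf a b c v att ω₀ i with hω
    set π := apexState att π₀ i with hπ
    set u := v i with hu'
    have hu : ∀ e ∈ ω, u ∉ e := ihfresh i le_rfl hi'
    have hua : u ≠ a := hva i hi'
    have hub : u ≠ b := hvb i hi'
    have huc : u ≠ c := hvc i hi'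
    rcases hatt : att i with ⟨x, y, z⟩
    have huA : u ∉ attFin a b c x y z := by
      rw [mem_attFin]; push Not; exact ⟨fun _ => hua, fun _ => hub, fun _ => huc⟩
    have hconf : conf a b c v att ω₀ (i + 1) = ω ∪ star u (attFin a b c x y z) := by
      simp only [conf, hatt, hω, hu']
    have hstate : apexState att π₀ (i + 1) = π.attach x y z := by simp only [apexState, hatt, hπ]
    have hattd : attached att (i + 1) = attached att i + (if x || y || z then 1 else 0) := by simp only [attached, hatt]
    -- reachability tools
    have RS := reachable_union_star ω hu (attFin a b c x y z) huA
    refine ⟨?_, ?_, ?_, ?_, ?_⟩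
    · -- count
      have hstep := clusterCount_attach a b c ω hu hua hub huc x y z π.rAB π.rAC π.rBC ihab ihac ihbc
      have hblk := P3.blocks_attach π x y z
      rw [hconf, hstate, hattd]
      have : π.dec x y z = (if x then 1 else 0) + (if y then (if x && π.rAB then 0 else 1) else 0) +
          (if z then (if (x && π.rAC) || (y && π.rBC) then 0 else 1) else 0) := rfl
      omega
    · -- reach a b
      have hau : a ≠ u := hua.symm
      have hbu : b ≠ u := hub.symm
      have hcu : c ≠ u := huc.symm
      have hba : (openGraph (↑ω : BondConfig V)).Reachable b a ↔ π.rAB = true := by rw [SimpleGraph.reachable_comm]; exact ihab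
      have hca : (openGraph (↑ω : BondConfig V)).Reachable c a ↔ π.rAC = true := by rw [SimpleGraph.reachable_comm]; exact ihac
      have hcb : (openGraph (↑ω : BondConfig V)).Reachable c b ↔ π.rBC = true := by rw [SimpleGraph.reachable_comm]; exact ihbc
      have haa : (openGraph (↑ω : BondConfig V)).Reachable a a ↔ True := iff_true_intro (SimpleGraph.Reachable.refl _)
      have hbb : (openGraph (↑ω : BondConfig V)).Reachable b b ↔ True := iff_true_intro (SimpleGraph.Reachable.refl _)
      have hcc : (openGraph (↑ω : BondConfig V)).Reachable c c ↔ True := iff_true_intro (SimpleGraph.Reachable.refl _)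
      rw [hconf, hstate, P3.rAB_attach, RS.1 a b hau hbu]
      simp only [exists_mem_attFin, ihab, ihac, hcb, haa, hbb]
      rcases Bool.eq_false_or_eq_true x with hx | hx <;> rcases Bool.eq_false_or_eq_true y with hy | hy <;>
        rcases Bool.eq_false_or_eq_true z with hz | hz <;> rcases Bool.eq_false_or_eq_true π.rAB with h1 | h1 <;>
        rcases Bool.eq_false_or_eq_true π.rAC with h2 | h2 <;> rcases Bool.eq_false_or_eq_true π.rBC with h3 | h3 <;>
        simp [hx, hy, hz, h1, h2, h3]
    · -- reach a c
      have hau : a ≠ u := hua.symm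
      have hbu : b ≠ u := hub.symm
      have hcu : c ≠ u := huc.symm
      have hba : (openGraph (↑ω : BondConfig V)).Reachable b a ↔ π.rAB = true := by rw [SimpleGraph.reachable_comm]; exact ihab
      have hca : (openGraph (↑ω : BondConfig V)).Reachable c a ↔ π.rAC = true := by rw [SimpleGraph.reachable_comm]; exact ihac
      have hcb : (openGraph (↑ω : BondConfig V)).Reachable c b ↔ π.rBC = true := by rw [SimpleGraph.reachable_comm]; exact ihbc
      have haa : (openGraph (↑ω : BondConfig V)).Reachable a a ↔ True := iff_true_intro (SimpleGraph.Reachable.refl _)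
      have hbb : (openGraph (↑ω : BondConfig V)).Reachable b b ↔ True := iff_true_intro (SimpleGraph.Reachable.refl _)
      have hcc : (openGraph (↑ω : BondConfig V)).Reachable c c ↔ True := iff_true_intro (SimpleGraph.Reachable.refl _)
      rw [hconf, hstate, P3.rAC_attach, RS.1 a c hau hcu]
      simp only [exists_mem_attFin, ihab, ihac, ihbc, haa, hcc]
      rcases Bool.eq_false_or_eq_true x with hx | hx <;> rcases Bool.eq_false_or_eq_true y with hy | hy <;>
        rcases Bool.eq_false_or_eq_true z with hz | hz <;> rcases Bool.eq_false_or_eq_true π.rAB with h1 | h1 <;>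
        rcases Bool.eq_false_or_eq_true π.rAC with h2 | h2 <;> rcases Bool.eq_false_or_eq_true π.rBC with h3 | h3 <;>
        simp [hx, hy, hz, h1, h2, h3]
    · -- reach b c
      have hau : a ≠ u := hua.symm
      have hbu : b ≠ u := hub.symm
      have hcu : c ≠ u := huc.symm
      have hba : (openGraph (↑ω : BondConfig V)).Reachable b a ↔ π.rAB = true := by rw [SimpleGraph.reachable_comm]; exact ihab
      have hca : (openGraph (↑ω : BondConfig V)).Reachable c a ↔ π.rAC = true := by rw [SimpleGraph.reachable_comm]; exact ihac
      have hcb : (openGraph (↑ω : BondConfig V)).Reachable c b ↔ π.rBC = true := by rw [SimpleGraph.reachable_comm]; exact ihbc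
      have haa : (openGraph (↑ω : BondConfig V)).Reachable a a ↔ True := iff_true_intro (SimpleGraph.Reachable.refl _)
      have hbb : (openGraph (↑ω : BondConfig V)).Reachable b b ↔ True := iff_true_intro (SimpleGraph.Reachable.refl _)
      have hcc : (openGraph (↑ω : BondConfig V)).Reachable c c ↔ True := iff_true_intro (SimpleGraph.Reachable.refl _)
      rw [hconf, hstate, P3.rBC_attach, RS.1 b c hbu hcu]
      simp only [exists_mem_attFin, hba, hbb, ihbc, ihac, hcc]
      rcases Bool.eq_false_or_eq_true x with hx | hx <;> rcases Bool.eq_false_or_eq_true y with hy | hy <;>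
        rcases Bool.eq_false_or_eq_true z with hz | hz <;> rcases Bool.eq_false_or_eq_true π.rAB with h1 | h1 <;>
        rcases Bool.eq_false_or_eq_true π.rAC with h2 | h2 <;> rcases Bool.eq_false_or_eq_true π.rBC with h3 | h3 <;>
        simp [hx, hy, hz, h1, h2, h3]
    · -- fresh
      intro j hij hj
      rw [hconf]
      have hjne : v j ≠ u := fun h => absurd (hinj j i hj hi' h) (by omega)
      have hvjA : v j ∉ attFin a b c x y z := by
        rw [mem_attFin]; push Not; exact ⟨fun _ => hva j hj, fun _ => hvb j hj, fun _ => hvc j hj⟩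
      exact fresh_union_star _ (ihfresh j (by omega) hj) hjne hvjA

end Concrete

end ThreeApex

end FK

end Summit.CriticalPhenomena.PercolationContinuityZ3.Theorems
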